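import Mathlib
import Literature.Analysis.Complex.LaplaceHalfLine
import Summits.AnomalousDissipation.AnomalousDissipation.Theorems.SoloBlindLaplaceOfExp

/-!
# Solo-blind kernel #278 — derivative and bounds of a resolvent read-out `F(z) = ℓ((z•1 − A)⁻¹ b)`

The source constants `B, B′` of kernel #271 (`strip_source_envelope`: bounds on `F = k̂_y` and on
`F′` over a convex region) for a read-out of RESOLVENT type, `F(z) = ℓ(R(z) b)` with
`R(z) = Ring.inverse (z•1 − A)` (`resolventElt` of #270):
* `hasDerivAt_inverse_resolventElt`: where `z•1 − A` is a unit, `d/dz R(z) = −R(z)²`;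
* `hasDerivAt_resolvent_readout`, `deriv_resolvent_readout`: `F′(z) = −ℓ(R(z)² b)`;
* `norm_resolvent_readout_le`: `‖F z‖ ≤ ‖ℓ‖ ‖R z‖ ‖b‖`;
  `norm_deriv_resolvent_readout_le`: `‖F′ z‖ ≤ ‖ℓ‖ ‖R z‖² ‖b‖`;
* `source_constants`: a uniform resolvent bound `‖R z‖ ≤ ρ` on a set gives `B = ‖ℓ‖ρ‖b‖`,
  `B′ = ‖ℓ‖ρ²‖b‖` there.
In a complete normed `ℂ`-algebra (the truncated chain: matrices; ENGINE-L-SPEC §13(a), §16(q)(iii)).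
-/

namespace Summit.AnomalousDissipation.SoloBlind.ResolventDerivative

open Summit.AnomalousDissipation.SoloBlind.LaplaceOfExp

variable {A : Type*} [NormedRing A] [NormedAlgebra ℂ A] [CompleteSpace A]

omit [CompleteSpace A] in
/-- `z ↦ z•1 − A` has derivative `1`. -/
theorem hasDerivAt_resolventElt (A0 : A) (z : ℂ) :
    HasDerivAt (fun w : ℂ => resolventElt w A0) (1 : A) z := by
  have h : HasDerivAt (fun w : ℂ => w • (1 : A)) ((1 : ℂ) • (1 : A)) z :=
    (hasDerivAt_id z).smul_const (1 : A)
  rw [one_smul] at h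
  have h2 := h.sub_const A0
  simpa [resolventElt] using h2

/-- **`d/dz (z•1 − A)⁻¹ = −R(z)²`** at points where `z•1 − A` is a unit. -/
theorem hasDerivAt_inverse_resolventElt (A0 : A) {z : ℂ} (hz : IsUnit (resolventElt z A0)) :
    HasDerivAt (fun w : ℂ => Ring.inverse (resolventElt w A0))
      (-(Ring.inverse (resolventElt z A0) * Ring.inverse (resolventElt z A0))) z := by
  obtain ⟨u, hu⟩ := hz
  have h1 := hasFDerivAt_ringInverse (𝕜 := ℂ) u
  rw [hu] at h1
  have h2 := h1.comp_hasDerivAt z (hasDerivAt_resolventElt A0 z)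
  have hinv : Ring.inverse (resolventElt z A0) = ↑u⁻¹ := by rw [← hu, Ring.inverse_unit]
  rw [hinv]
  have h3 : HasDerivAt (fun w : ℂ => Ring.inverse (resolventElt w A0))
      ((-ContinuousLinearMap.mulLeftRight ℂ A ↑u⁻¹ ↑u⁻¹) (1 : A)) z := h2
  refine h3.congr_deriv ?_
  simp

/-- **Derivative of the read-out**: `F′(z) = −ℓ(R(z)² b)`. -/
theorem hasDerivAt_resolvent_readout (A0 : A) (ℓ : A →L[ℂ] ℂ) (b : A) {z : ℂ}
    (hz : IsUnit (resolventElt z A0)) :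
    HasDerivAt (fun w : ℂ => ℓ (Ring.inverse (resolventElt w A0) * b))
      (-(ℓ (Ring.inverse (resolventElt z A0) * Ring.inverse (resolventElt z A0) * b))) z := by
  have h1 := (hasDerivAt_inverse_resolventElt A0 hz).mul_const b
  have h2 := ℓ.hasFDerivAt.comp_hasDerivAt z h1
  simpa [Function.comp_def, neg_mul] using h2

/-- The derivative, as a value of `deriv`. -/
theorem deriv_resolvent_readout (A0 : A) (ℓ : A →L[ℂ] ℂ) (b : A) {z : ℂ}
    (hz : IsUnit (resolventElt z A0)) :
    deriv (fun w : ℂ => ℓ (Ring.inverse (resolventElt w A0) * b)) z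
      = -(ℓ (Ring.inverse (resolventElt z A0) * Ring.inverse (resolventElt z A0) * b)) :=
  (hasDerivAt_resolvent_readout A0 ℓ b hz).deriv

omit [CompleteSpace A] in
/-- `‖F z‖ ≤ ‖ℓ‖ ‖R z‖ ‖b‖`. -/
theorem norm_resolvent_readout_le (A0 : A) (ℓ : A →L[ℂ] ℂ) (b : A) (z : ℂ) :
    ‖ℓ (Ring.inverse (resolventElt z A0) * b)‖ ≤ ‖ℓ‖ * ‖Ring.inverse (resolventElt z A0)‖ * ‖b‖ := by
  calc ‖ℓ (Ring.inverse (resolventElt z A0) * b)‖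
      ≤ ‖ℓ‖ * ‖Ring.inverse (resolventElt z A0) * b‖ := ℓ.le_opNorm _
    _ ≤ ‖ℓ‖ * (‖Ring.inverse (resolventElt z A0)‖ * ‖b‖) := by
        gcongr; exact norm_mul_le _ _
    _ = ‖ℓ‖ * ‖Ring.inverse (resolventElt z A0)‖ * ‖b‖ := by ring

/-- `‖F′ z‖ ≤ ‖ℓ‖ ‖R z‖² ‖b‖`. -/
theorem norm_deriv_resolvent_readout_le (A0 : A) (ℓ : A →L[ℂ] ℂ) (b : A) {z : ℂ}
    (hz : IsUnit (resolventElt z A0)) :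
    ‖deriv (fun w : ℂ => ℓ (Ring.inverse (resolventElt w A0) * b)) z‖
      ≤ ‖ℓ‖ * ‖Ring.inverse (resolventElt z A0)‖ ^ 2 * ‖b‖ := by
  rw [deriv_resolvent_readout A0 ℓ b hz, norm_neg]
  calc ‖ℓ (Ring.inverse (resolventElt z A0) * Ring.inverse (resolventElt z A0) * b)‖
      ≤ ‖ℓ‖ * ‖Ring.inverse (resolventElt z A0) * Ring.inverse (resolventElt z A0) * b‖ :=
        ℓ.le_opNorm _
    _ ≤ ‖ℓ‖ * (‖Ring.inverse (resolventElt z A0)‖ * ‖Ring.inverse (resolventElt z A0)‖ * ‖b‖) := by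
        gcongr
        exact le_trans (norm_mul_le _ _) (mul_le_mul_of_nonneg_right (norm_mul_le _ _) (norm_nonneg _))
    _ = ‖ℓ‖ * ‖Ring.inverse (resolventElt z A0)‖ ^ 2 * ‖b‖ := by ring

/-- **Source constants from a uniform resolvent bound.**  If `z•1 − A` is a unit with
`‖(z•1 − A)⁻¹‖ ≤ ρ` for every `z ∈ U`, then on `U`: `F` is differentiable, `‖F‖ ≤ ‖ℓ‖ρ‖b‖` and
`‖F′‖ ≤ ‖ℓ‖ρ²‖b‖` — the hypotheses `hd`, `hB`, `hB'` of #271 `strip_source_envelope` /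
`norm_src_le_near`. -/
theorem source_constants (A0 : A) (ℓ : A →L[ℂ] ℂ) (b : A) {U : Set ℂ} {ρ : ℝ}
    (hunit : ∀ z ∈ U, IsUnit (resolventElt z A0))
    (hρ : ∀ z ∈ U, ‖Ring.inverse (resolventElt z A0)‖ ≤ ρ) :
    (∀ z ∈ U, DifferentiableAt ℂ (fun w : ℂ => ℓ (Ring.inverse (resolventElt w A0) * b)) z) ∧
    (∀ z ∈ U, ‖ℓ (Ring.inverse (resolventElt z A0) * b)‖ ≤ ‖ℓ‖ * ρ * ‖b‖) ∧
    (∀ z ∈ U, ‖deriv (fun w : ℂ => ℓ (Ring.inverse (resolventElt w A0) * b)) z‖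
      ≤ ‖ℓ‖ * ρ ^ 2 * ‖b‖) := by
  refine ⟨fun z hz => (hasDerivAt_resolvent_readout A0 ℓ b (hunit z hz)).differentiableAt,
    fun z hz => ?_, fun z hz => ?_⟩
  · have hρ0 : 0 ≤ ρ := le_trans (norm_nonneg _) (hρ z hz)
    calc _ ≤ ‖ℓ‖ * ‖Ring.inverse (resolventElt z A0)‖ * ‖b‖ := norm_resolvent_readout_le A0 ℓ b z
      _ ≤ ‖ℓ‖ * ρ * ‖b‖ := by gcongr; exact hρ z hz
  · have hρ0 : 0 ≤ ρ := le_trans (norm_nonneg _) (hρ z hz)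
    calc _ ≤ ‖ℓ‖ * ‖Ring.inverse (resolventElt z A0)‖ ^ 2 * ‖b‖ :=
          norm_deriv_resolvent_readout_le A0 ℓ b (hunit z hz)
      _ ≤ ‖ℓ‖ * ρ ^ 2 * ‖b‖ := by
          gcongr
          exact hρ z hz

end Summit.AnomalousDissipation.SoloBlind.ResolventDerivative
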